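import Summits.Ventures.DiscreteObjects.UnitDistance.PlaneSqrt11WitnessData
import HarnessLib

/-!
# The 109-vertex unit-distance graph over `ℚ(√11)` is not 3-colourable — kernel search

Framing (verbatim for the cell): lottery ticket; floor = certified bounds/negative ranges.

The bit-vector search of `KernelColouringSearch.lean` (unit propagation + PASS branching, soundness `KBits.search_sound`) run
on the data of `PlaneSqrt11WitnessData.lean` from the initial words (`43 ↦ 0`, `94 ↦ 1`, colour `3` forbidden everywhere):
every branch dies (a few hundred branch nodes, < 10⁶ bit operations by the Python mirror `code/udg12/kbits3.py`; one `decide +kernel`).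
Consequence (`PlaneSqrt11Four.lean`): `χ(ℚ(√11)²) = 4`.
-/

namespace Summit.Ventures.DiscreteObjects.UnitDistance

open KBits

/-- The root run: propagate the initial forced colours, then search to the end. -/
def w11run : Bool :=
  match propagate w11nb 40 (w11C0, w11C1, w11C2, 0, 2 ^ 109 - 1) with
  | none => true
  | some st => search w11nb 109 40 [] 109 st

set_option maxHeartbeats 400000000 in
set_option maxRecDepth 200000 in
/-- KERNEL FACT: the search closes (every branch reaches a dead end). -/
theorem w11run_eq : w11run = true := by
  decide +kernel

end Summit.Ventures.DiscreteObjects.UnitDistance
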